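import Literature.NumberTheory.Weil1964.UnitaryArchLocalSkewCongr                 -- FILE 1 (this seat): `exists_conjEquivC`, `cayleyWeightC_conj`, `map_conjEquiv_lieStdLebesgueC`, `cayleyC_conj`
import Literature.NumberTheory.Automorphic.UnitaryFormGroupUnimodular            -- ★ `locallyCompactSpace_unitaryGroupOfForm_complex`, `secondCountableTopology_…`
import HarnessLib

/-!
# Local congruence transport of the top-form Haar measure of `U(Jw)(ℂ)`: `g ↦ T g T⁻¹` carries chart measures to chart measures and — given the window identities —
# `localTopFormHaar J₂` to `localTopFormHaar J` ((U) road, U4-DISCHARGE (cpt) half, LEAD WORD T9-40 (d2); one-place replica of ★ B1″-C §2–§3; Rogawski 1990 §1.7 «`dg′ = |ψ^*Ω|`»)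

Topic `NumberTheory/Weil1964`; namespace `Literature.NumberTheory.Weil1964.UnitaryArchLocalTopForm`.  THEOREMS ONLY (no `def`, no instance, no notation, no axiom, no named fact,
no `sorry`).  Cell `pub/hodgecm-mathlib`, crux H413 = `stmt-HodgeConjecture-24833` (supports only).  Count-neutral plumbing.  HONEST LABEL: HC_CM is proved only modulo the
printed citations until rung 0 closes.  Sequel of FILE 1 `UnitaryArchLocalSkewCongr` (the Lie-algebra level).

* §2 the congruence `Φ = (T · T⁻¹) : U(J₂)(ℂ) ≃ₜ* U(J)(ℂ)` intertwines the Cayley charts (`conj_cayleyChartC`, `image_cayleyChartC_image_conjEquiv`) and carries chart measures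
  to chart measures (**`map_conj_cayleyChartMeasureC`**: `Φ_* (ĉ_{J₂})_*(w₀ λ_{J₂}|_V) = (ĉ_J)_*(w₀ λ_J|_{Ad T (V)})`).
* §3 **`map_localTopFormHaar_of_conj_of_window`**: GIVEN the window identity for `J₂` at its window of record and the ANY-window identity for `J` (both = the one-place slice
  of ★ (P0) `archTopFormHaar_restrict_image_of_isOpen`, U4-discharge piece (ii), A-p06 (g29)), `Φ_* localTopFormHaar J₂ = localTopFormHaar J` — two Haar measures agreeing on
  an open set of positive finite measure (Haar uniqueness `isMulLeftInvariant_eq_smul`).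

## References
* [Rogawski1990] J. D. Rogawski, *Automorphic Representations of Unitary Groups in Three Variables*, Ann. of Math. Stud. 123 (1990), §1.7 p. 6.
* [Helgason2000] S. Helgason, *Groups and Geometric Analysis*, AMS Math. Surveys Monogr. 83 (2000), Ch. I §1 Thm. 1.14 p. 96.
* [Weyl1939] H. Weyl, *The Classical Groups* (1939), Ch. II §10.
-/

set_option autoImplicit false
-- the scoped normed structure on the submodule `𝔲(Jw) ≤ M_N(ℂ)` vs the `[BorelSpace ↥(skewC …)]` binder's subtype topology (as in ★ U1 FILE B ∕ ★ B1″-C)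
set_option backward.isDefEq.respectTransparency false

noncomputable section

open Set Filter Topology MeasureTheory MeasureTheory.Measure Literature.Analysis.Calculus
open scoped Classical Matrix Matrix.Norms.Operator MatrixGroups ENNReal NNReal Pointwise

namespace Literature.NumberTheory.Weil1964

namespace UnitaryArchLocalTopForm

open Literature.NumberTheory.Automorphic Literature.NumberTheory.Automorphic.UnitaryGroup

/-! ## §2 The congruence intertwines the Cayley charts and carries chart measures to chart measures -/

section Chart

variable {N : ℕ} {Jw Jw₂ : Matrix (Fin N) (Fin N) ℂ}

/-- **`Φ (ĉ_{J₂} X) = ĉ_J (T X T⁻¹)`** for `Φ = (T · T⁻¹)` and `X` in the source (`cayleyC_conj`). [cite: Weyl1939, Ch. II §10] -/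
theorem conj_cayleyChartC {T : GL (Fin N) ℂ} (Φ : unitaryGroupOfForm (starRingEnd ℂ) Jw₂ ≃ₜ* unitaryGroupOfForm (starRingEnd ℂ) Jw)
    (hΦ : ∀ g : unitaryGroupOfForm (starRingEnd ℂ) Jw₂, ((Φ g : unitaryGroupOfForm (starRingEnd ℂ) Jw) : GL (Fin N) ℂ) = T * (g : GL (Fin N) ℂ) * T⁻¹)
    (e : skewC N Jw₂ ≃L[ℝ] skewC N Jw)
    (he : ∀ X : skewC N Jw₂, ((e X : skewC N Jw) : Matrix (Fin N) (Fin N) ℂ) = (T : Matrix (Fin N) (Fin N) ℂ) * (X : Matrix (Fin N) (Fin N) ℂ) * ((T⁻¹ : GL (Fin N) ℂ) : Matrix (Fin N) (Fin N) ℂ))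
    {X : skewC N Jw₂} (hX : X ∈ cayleySourceC N Jw₂) :
    Φ (cayleyChartC N Jw₂ X) = cayleyChartC N Jw (e X) := by
  have hX' : e X ∈ cayleySourceC N Jw := conj_mem_cayleySourceC e he hX
  apply Subtype.ext
  apply Units.ext
  rw [hΦ, Units.val_mul, Units.val_mul, coe_cayleyChartC hX, coe_cayleyChartC hX', he, cayleyC_conj T hX.1]

/-- The chart image of a transported set is the `Φ`-image of the chart image: `ĉ_J(e(V)) = Φ(ĉ_{J₂}(V))` for `V ⊆ source`. [cite: Weyl1939, Ch. II §10] -/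
theorem image_cayleyChartC_image_conjEquiv {T : GL (Fin N) ℂ} (Φ : unitaryGroupOfForm (starRingEnd ℂ) Jw₂ ≃ₜ* unitaryGroupOfForm (starRingEnd ℂ) Jw)
    (hΦ : ∀ g : unitaryGroupOfForm (starRingEnd ℂ) Jw₂, ((Φ g : unitaryGroupOfForm (starRingEnd ℂ) Jw) : GL (Fin N) ℂ) = T * (g : GL (Fin N) ℂ) * T⁻¹)
    (e : skewC N Jw₂ ≃L[ℝ] skewC N Jw)
    (he : ∀ X : skewC N Jw₂, ((e X : skewC N Jw) : Matrix (Fin N) (Fin N) ℂ) = (T : Matrix (Fin N) (Fin N) ℂ) * (X : Matrix (Fin N) (Fin N) ℂ) * ((T⁻¹ : GL (Fin N) ℂ) : Matrix (Fin N) (Fin N) ℂ))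
    {V : Set (skewC N Jw₂)} (hV : V ⊆ cayleySourceC N Jw₂) :
    cayleyChartC N Jw '' (e '' V) = Φ '' (cayleyChartC N Jw₂ '' V) := by
  rw [Set.image_image, Set.image_image]
  exact Set.image_congr fun X hX => (conj_cayleyChartC Φ hΦ e he (hV hX)).symm

variable [MeasurableSpace (skewC N Jw)] [BorelSpace (skewC N Jw)] [MeasurableSpace (skewC N Jw₂)] [BorelSpace (skewC N Jw₂)]
  [MeasurableSpace (GL (Fin N) ℂ)] [BorelSpace (GL (Fin N) ℂ)]

/-- `withDensity` transported along a measurable equivalence: `e_*(μ · f) = (e_* μ) · (f ∘ e⁻¹)`. [folklore] -/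
private theorem map_withDensity_equivC {α β : Type*} [MeasurableSpace α] [MeasurableSpace β] (μ : Measure α) (em : α ≃ᵐ β) (f : α → ℝ≥0∞) :
    (μ.withDensity f).map em = (μ.map em).withDensity (f ∘ em.symm) := by
  ext s hs
  rw [Measure.map_apply em.measurable hs, withDensity_apply _ (em.measurable hs), withDensity_apply _ hs, em.restrict_map, lintegral_map_equiv]
  simp only [Function.comp_apply, em.symm_apply_apply]

/-- **`Φ_*` CARRIES CHART MEASURES TO CHART MEASURES**: `Φ_* (ĉ_{J₂})_*(w₀ · λ_{J₂}|_V) = (ĉ_J)_*(w₀ · λ_J|_{e(V)})` for measurable `V ⊆ source` — charts intertwined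
(`conj_cayleyChartC`), weight invariant (`cayleyWeightC_conj`), Lebesgue measure transported (`map_conjEquiv_lieStdLebesgueC`). [cite: Helgason2000, Ch. I §1 Thm. 1.14 p. 96] [cite: Rogawski1990, §1.7 p. 6] -/
theorem map_conj_cayleyChartMeasureC {T : GL (Fin N) ℂ} (Φ : unitaryGroupOfForm (starRingEnd ℂ) Jw₂ ≃ₜ* unitaryGroupOfForm (starRingEnd ℂ) Jw)
    (hΦ : ∀ g : unitaryGroupOfForm (starRingEnd ℂ) Jw₂, ((Φ g : unitaryGroupOfForm (starRingEnd ℂ) Jw) : GL (Fin N) ℂ) = T * (g : GL (Fin N) ℂ) * T⁻¹)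
    (e : skewC N Jw₂ ≃L[ℝ] skewC N Jw)
    (he : ∀ X : skewC N Jw₂, ((e X : skewC N Jw) : Matrix (Fin N) (Fin N) ℂ) = (T : Matrix (Fin N) (Fin N) ℂ) * (X : Matrix (Fin N) (Fin N) ℂ) * ((T⁻¹ : GL (Fin N) ℂ) : Matrix (Fin N) (Fin N) ℂ))
    {V : Set (skewC N Jw₂)} (hVs : V ⊆ cayleySourceC N Jw₂) (hVm : MeasurableSet V) :
    Measure.map Φ (cayleyChartMeasureC N Jw₂ (lieStdLebesgueC N Jw₂) V) = cayleyChartMeasureC N Jw (lieStdLebesgueC N Jw) (e '' V) := by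
  set em : skewC N Jw₂ ≃ᵐ skewC N Jw := e.toHomeomorph.toMeasurableEquiv with hem_def
  have hem : (⇑em : skewC N Jw₂ → skewC N Jw) = ⇑e := rfl
  have hems : ∀ Y, em.symm Y = e.symm Y := fun _ => rfl
  set ρ₂ := ((lieStdLebesgueC N Jw₂).restrict V).withDensity fun X => ENNReal.ofReal (cayleyWeightC N Jw₂ X) with hρ₂
  have hae : (⇑Φ ∘ cayleyChartC N Jw₂) =ᵐ[ρ₂] (cayleyChartC N Jw ∘ ⇑e) := by
    have h1 : ∀ᵐ X ∂ρ₂, X ∈ V := (withDensity_absolutelyContinuous _ _).ae_le (ae_restrict_mem hVm)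
    filter_upwards [h1] with X hX
    exact conj_cayleyChartC Φ hΦ e he (hVs hX)
  have hΦmeas : Measurable (⇑Φ : unitaryGroupOfForm (starRingEnd ℂ) Jw₂ → unitaryGroupOfForm (starRingEnd ℂ) Jw) := Φ.continuous.measurable
  have hemeas : Measurable (⇑e : skewC N Jw₂ → skewC N Jw) := e.continuous.measurable
  rw [cayleyChartMeasureC, cayleyChartMeasureC, ← hρ₂, Measure.map_map hΦmeas measurable_cayleyChartC, Measure.map_congr hae, ← Measure.map_map measurable_cayleyChartC hemeas]
  congr 1
  have hres : Measure.map em ((lieStdLebesgueC N Jw₂).restrict V) = (lieStdLebesgueC N Jw).restrict (e '' V) := by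
    rw [← map_conjEquiv_lieStdLebesgueC (Jw := Jw) (Jw₂ := Jw₂) e he, ← hem, em.restrict_map, em.injective.preimage_image]
  rw [hρ₂, ← hem, map_withDensity_equivC _ em, hres, hem]
  congr 1
  funext Y
  rw [Function.comp_apply, hems, ← cayleyWeightC_conj (Jw := Jw) e he (e.symm Y), e.apply_symm_apply]

end Chart

/-! ## §3 The transport theorem modulo the window identities -/

section Transport

variable {N : ℕ} {Jw Jw₂ : Matrix (Fin N) (Fin N) ℂ}
  [MeasurableSpace (GL (Fin N) ℂ)] [BorelSpace (GL (Fin N) ℂ)]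

/-- **CONGRUENCE TRANSPORT OF THE ONE-PLACE TOP-FORM HAAR MEASURE, modulo the window identities.**  Let `Tᴴ J T = J₂` and `Φ : U(J₂)(ℂ) ≃ₜ* U(J)(ℂ)` act by `g ↦ T g T⁻¹`.
IF `localTopFormHaar J₂` satisfies the window identity at its window of record (`hwin₂`) and `localTopFormHaar J` satisfies it at EVERY relatively compact open window in the source
(`hwin`; both are the one-place slice of ★ (P0) `archTopFormHaar_restrict_image_of_isOpen`), THEN `Φ_* localTopFormHaar J₂ = localTopFormHaar J`: the two are Haar measures on
`U(J)(ℂ)` agreeing on the open set `ĉ_J(Ad T (W₂)) = Φ(ĉ_{J₂}(W₂))` of positive finite measure (`map_conj_cayleyChartMeasureC`), hence equal (Haar uniqueness).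
[cite: Rogawski1990, §1.7 p. 6] [cite: Helgason2000, Ch. I §1 Thm. 1.14 p. 96] -/
theorem map_localTopFormHaar_of_conj_of_window (hnd : lieGramDetC N Jw ≠ 0) {T : GL (Fin N) ℂ} (h : formCongr (starRingEnd ℂ) T Jw = Jw₂)
    (Φ : unitaryGroupOfForm (starRingEnd ℂ) Jw₂ ≃ₜ* unitaryGroupOfForm (starRingEnd ℂ) Jw)
    (hΦ : ∀ g : unitaryGroupOfForm (starRingEnd ℂ) Jw₂, ((Φ g : unitaryGroupOfForm (starRingEnd ℂ) Jw) : GL (Fin N) ℂ) = T * (g : GL (Fin N) ℂ) * T⁻¹)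
    (hwin₂ : (localTopFormHaar N Jw₂).restrict (cayleyChartC N Jw₂ '' windowC N Jw₂) =
      (letI : MeasurableSpace (skewC N Jw₂) := borel _
       haveI : BorelSpace (skewC N Jw₂) := ⟨rfl⟩
       cayleyChartMeasureC N Jw₂ (lieStdLebesgueC N Jw₂) (windowC N Jw₂)))
    (hwin : ∀ (V K : Set (skewC N Jw)), IsOpen V → (0 : skewC N Jw) ∈ V → IsCompact K → K ⊆ cayleySourceC N Jw → V ⊆ K →
      (localTopFormHaar N Jw).restrict (cayleyChartC N Jw '' V) =
        (letI : MeasurableSpace (skewC N Jw) := borel _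
         haveI : BorelSpace (skewC N Jw) := ⟨rfl⟩
         cayleyChartMeasureC N Jw (lieStdLebesgueC N Jw) V)) :
    Measure.map Φ (localTopFormHaar N Jw₂) = localTopFormHaar N Jw := by
  letI iM : MeasurableSpace (skewC N Jw) := borel _
  haveI iB : BorelSpace (skewC N Jw) := ⟨rfl⟩
  letI iM₂ : MeasurableSpace (skewC N Jw₂) := borel _
  haveI iB₂ : BorelSpace (skewC N Jw₂) := ⟨rfl⟩
  haveI : FiniteDimensional ℝ (Matrix (Fin N) (Fin N) ℂ) := finiteDimensional_matrixC
  haveI := locallyCompactSpace_unitaryGroupOfForm_complex (n := Fin N) Jw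
  haveI := locallyCompactSpace_unitaryGroupOfForm_complex (n := Fin N) Jw₂
  haveI := secondCountableTopology_unitaryGroupOfForm_complex (n := Fin N) Jw
  obtain ⟨e, he⟩ := exists_conjEquivC (Jw := Jw) (Jw₂ := Jw₂) h
  have hnd₂ : lieGramDetC N Jw₂ ≠ 0 := (lieGramDetC_ne_zero_iff_of_conj e he).1 hnd
  haveI := isHaarMeasure_localTopFormHaar (N := N) (Jw := Jw) hnd
  haveI := isHaarMeasure_localTopFormHaar (N := N) (Jw := Jw₂) hnd₂
  haveI : (Measure.map Φ (localTopFormHaar N Jw₂)).IsHaarMeasure := ContinuousMulEquiv.isHaarMeasure_map _ Φ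
  -- the transported window and its compact hull
  have hVo : IsOpen (e '' windowC N Jw₂) := e.toHomeomorph.isOpenMap _ isOpen_windowC
  have h0 : (0 : skewC N Jw) ∈ e '' windowC N Jw₂ := ⟨0, zero_mem_windowC, map_zero e⟩
  have hK : IsCompact (e '' Metric.closedBall (0 : skewC N Jw₂) (windowRadiusC N Jw₂)) := (isCompact_closedBall _ _).image e.continuous
  have hKs : e '' Metric.closedBall (0 : skewC N Jw₂) (windowRadiusC N Jw₂) ⊆ cayleySourceC N Jw := by
    rintro _ ⟨X, hX, rfl⟩
    exact conj_mem_cayleySourceC e he (closedBall_windowRadiusC_subset hX)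
  have hVK : e '' windowC N Jw₂ ⊆ e '' Metric.closedBall (0 : skewC N Jw₂) (windowRadiusC N Jw₂) := Set.image_mono Metric.ball_subset_closedBall
  -- the two Haar measures agree on the open set `O = ĉ_J(e(W₂)) = Φ(ĉ_{J₂}(W₂))`
  set O := cayleyChartC N Jw '' (e '' windowC N Jw₂) with hO
  have hOeq : O = Φ '' (cayleyChartC N Jw₂ '' windowC N Jw₂) := image_cayleyChartC_image_conjEquiv Φ hΦ e he windowC_subset_cayleySourceC
  set Φm : unitaryGroupOfForm (starRingEnd ℂ) Jw₂ ≃ᵐ unitaryGroupOfForm (starRingEnd ℂ) Jw := Φ.toHomeomorph.toMeasurableEquiv with hΦm_def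
  have hΦm : (⇑Φm : unitaryGroupOfForm (starRingEnd ℂ) Jw₂ → unitaryGroupOfForm (starRingEnd ℂ) Jw) = ⇑Φ := rfl
  have hpre : ⇑Φm ⁻¹' (⇑Φm '' (cayleyChartC N Jw₂ '' windowC N Jw₂)) = cayleyChartC N Jw₂ '' windowC N Jw₂ := Φm.injective.preimage_image _
  have hagree : (Measure.map Φ (localTopFormHaar N Jw₂)).restrict O = (localTopFormHaar N Jw).restrict O := by
    rw [hwin _ _ hVo h0 hK hKs hVK, hOeq, ← hΦm, Φm.restrict_map, hpre, hwin₂, hΦm]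
    exact map_conj_cayleyChartMeasureC Φ hΦ e he windowC_subset_cayleySourceC isOpen_windowC.measurableSet
  -- `O` is open, nonempty, with compact closure: positive finite Haar measure
  have hOo : IsOpen O := isOpen_image_cayleyChartC (hVK.trans hKs) hVo
  have hOne : O.Nonempty := ⟨_, ⟨0, h0, rfl⟩⟩
  have hOc : IsCompact (closure O) := by
    have h1 : IsCompact (⇑Φ '' closure (cayleyChartC N Jw₂ '' windowC N Jw₂)) := isCompact_closure_image_windowC.image Φ.continuous
    refine h1.closure_of_subset ?_
    rw [hOeq]
    exact Set.image_mono subset_closure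
  have hO0 : localTopFormHaar N Jw O ≠ 0 := (hOo.measure_pos _ hOne).ne'
  have hOtop : localTopFormHaar N Jw O ≠ ⊤ := ((measure_mono subset_closure).trans_lt hOc.measure_lt_top).ne
  -- Haar uniqueness
  have hs := isMulLeftInvariant_eq_smul (Measure.map Φ (localTopFormHaar N Jw₂)) (localTopFormHaar N Jw)
  have hval : (Measure.map Φ (localTopFormHaar N Jw₂)) O = localTopFormHaar N Jw O := by
    have := congrArg (fun m : Measure (unitaryGroupOfForm (starRingEnd ℂ) Jw) => m O) hagree
    simpa only [Measure.restrict_apply_self] using this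
  rw [hs, Measure.smul_apply, ENNReal.smul_def, smul_eq_mul] at hval
  have hc : (haarScalarFactor (Measure.map Φ (localTopFormHaar N Jw₂)) (localTopFormHaar N Jw) : ℝ≥0∞) = 1 :=
    (ENNReal.mul_left_inj hO0 hOtop).1 (hval.trans (one_mul _).symm)
  have hc' : haarScalarFactor (Measure.map Φ (localTopFormHaar N Jw₂)) (localTopFormHaar N Jw) = 1 := ENNReal.coe_eq_one.1 hc
  rw [hs, hc', one_smul]

end Transport

end UnitaryArchLocalTopForm

end Literature.NumberTheory.Weil1964

end
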